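import Mathlib
import Summits.NavierStokesRegularity.FluidComputer.AbcClassIIEigenpairOfComplexBases
import Summits.NavierStokesRegularity.FluidComputer.BorderedEigenpairApproxInverse

/-!
# GROUP-B END-TO-END ON THE MODEL, CLASS II, IN ARBITRARY **COMPLEX** ORBIT BASES — from the certifiers'
# FLOAT-INVERSE DATA (profile-cert-3 g8, 2026-08-27)
HONEST FRAMING (D-0035/D-0074): not a claim about Navier–Stokes blow-up. WHAT THIS IS NOT: not NS evidence;
MODEL lane (NS linearised about the forced ABC flow `abcFlow 1 1 1`, class II); no certificate, number or
census word moves. cert-3 g7's `…_of_approx_inverse_of_bases` (the posited EXACT bordered left inverse + bounds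
+ `Binv`-shell number REPLACED by the float-inverse data the 3-B-nested certifiers print: θ ≥ ‖I − X̃Â₀‖₂, nX,
yB, nB, yC, nC, xmu, ygB, MU2X; α = nX/(1−θ), δ = αθ, β_B = yB + nB δ, β_C' = yC + nC δ + nt (xmu + δ),
g_B = ygB + nB δ, MU2 = MU2X − nB nC δ, via `BorderedEigenpairApproxInverse.exists_borderedInverse_of_approx`)
restated for the COMPLEX first-order matrix `amc` of an arbitrary family of complex orthonormal orbit bases (the
bases the CR implementations compute in, cert-3 g8) on top of `isLinNSEigenvalue_near_of_nested_certificate_of_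
complex_bases`. Conclusion verbatim. Mathlib + the two files named; no new definitions. bears_on LADDER-NS N5 /
Z4-a(1) (FORMAT: the X̃-level row statement for any implementation that prints the raw X̃-primaries).
-/

noncomputable section

open scoped BigOperators ComplexConjugate InnerProductSpace
open Finset

namespace Summit.NavierStokesRegularity.FluidComputer.AbcClassIIEigenpair

open Literature.Analysis.FunctionSpaces Literature.Analysis.FunctionSpaces.Torus
open Literature.Analysis.FluidPDE
open Summit.NavierStokesRegularity.FluidComputer.AbcClassII

section OfComplexBases

variable (wf : Idx → Fam)
variable (hws : ∀ i : Idx, ∀ k ∉ i.1.1, wf i k = 0)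
variable (hwt : ∀ (i : Idx) (k : Fin 3 → ℤ), ∑ j : Fin 3, ((k j : ℤ) : ℂ) * wf i k j = 0)
variable (hwII : ∀ i : Idx, IsClassII (wf i))
variable (hwon : ∀ (O : Orbit) (a b : Fin (odim O)),
  ∑ k ∈ O.1, (inner ℂ (wf ⟨O, a⟩ k) (wf ⟨O, b⟩ k) : ℂ) = if a = b then 1 else 0)
variable (amc : Idx → Idx → ℂ)
variable (hamc : ∀ i j : Idx, amc i j =
  ∑ k ∈ i.1.1, (inner ℂ (wf i k) (Torus.lerayCoeff k (crossForm 1 1 1 (wf j) k)) : ℂ))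

include hws hwt hwII hwon hamc in

/-- **GROUP-B END-TO-END ON THE MODEL (class II), arbitrary COMPLEX orbit bases, from float-inverse data.** -/
theorem isLinNSEigenvalue_near_of_nested_certificate_of_approx_inverse_of_complex_bases {R : ℝ} (hR : 1 ≤ R)
    (K Kv : ℕ) (lt : ℂ)
    (vt : Idx → ℂ) (hvt0 : ∀ i, i ∉ cubeIdx Kv → vt i = 0)
    {r₀ nt : ℝ} (hr₀ : 0 ≤ r₀) (hnt : 0 ≤ nt)
    (hres : ∑ i ∈ cubeIdx Kv ∪ (cubeIdx Kv).biUnion nbrIdx,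
      ‖(if i ∈ cubeIdx Kv then (lt - ((-(onormSq i.1 / R) : ℝ) : ℂ)) * vt i else 0) -
        ∑ j ∈ cubeIdx Kv, amc i j * vt j‖ ^ 2 ≤ r₀ ^ 2)
    (hntb : ∑ i ∈ cubeIdx Kv \ cubeIdx K, ‖vt i‖ ^ 2 ≤ nt ^ 2)
    -- the float inverse of the bordered Galerkin matrix and its certified data
    (X : ((↥(cubeIdx K) → ℂ) × ℂ) →ₗ[ℂ] ((↥(cubeIdx K) → ℂ) × ℂ))
    {θ nX yB nB yC nC xmu ygB MU2X : ℝ}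
    (hθ0 : 0 ≤ θ) (hθ1 : θ < 1) (hnX0 : 0 ≤ nX) (hyB0 : 0 ≤ yB) (hnB0 : 0 ≤ nB)
    (hyC0 : 0 ≤ yC) (hnC0 : 0 ≤ nC) (hxmu0 : 0 ≤ xmu) (hygB0 : 0 ≤ ygB)
    (hθ : ∀ (c : ↥(cubeIdx K) → ℂ) (m : ℂ),
      ∑ j : ↥(cubeIdx K), ‖c j - (X (fun i : ↥(cubeIdx K) =>
          (lt - ((-(onormSq i.1.1 / R) : ℝ) : ℂ)) * c i -
          ∑ j : ↥(cubeIdx K), amc i j * c j + m * vt i,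
          ∑ i : ↥(cubeIdx K), conj (vt i) * c i)).1 j‖ ^ 2 +
        ‖m - (X (fun i : ↥(cubeIdx K) =>
          (lt - ((-(onormSq i.1.1 / R) : ℝ) : ℂ)) * c i -
          ∑ j : ↥(cubeIdx K), amc i j * c j + m * vt i,
          ∑ i : ↥(cubeIdx K), conj (vt i) * c i)).2‖ ^ 2 ≤
        θ ^ 2 * (∑ j : ↥(cubeIdx K), ‖c j‖ ^ 2 + ‖m‖ ^ 2))
    (hnX : ∀ (c : ↥(cubeIdx K) → ℂ) (g : ℂ),
      ∑ j : ↥(cubeIdx K), ‖(X (c, g)).1 j‖ ^ 2 + ‖(X (c, g)).2‖ ^ 2 ≤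
        nX ^ 2 * (∑ j : ↥(cubeIdx K), ‖c j‖ ^ 2 + ‖g‖ ^ 2))
    (hyB : ∀ e : Idx → ℂ,
      ∑ j : ↥(cubeIdx K), ‖(X (fun i : ↥(cubeIdx K) => -∑ j ∈ nbrIdx i \ cubeIdx K,
          amc i j * e j, 0)).1 j‖ ^ 2 +
        ‖(X (fun i : ↥(cubeIdx K) => -∑ j ∈ nbrIdx i \ cubeIdx K,
          amc i j * e j, 0)).2‖ ^ 2 ≤
        yB ^ 2 * ∑ j ∈ (cubeIdx K).biUnion nbrIdx \ cubeIdx K, ‖e j‖ ^ 2)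
    (hnB : ∀ e : Idx → ℂ,
      ∑ i : ↥(cubeIdx K), ‖∑ j ∈ nbrIdx i \ cubeIdx K, amc i j * e j‖ ^ 2 ≤
        nB ^ 2 * ∑ j ∈ (cubeIdx K).biUnion nbrIdx \ cubeIdx K, ‖e j‖ ^ 2)
    (hyC : ∀ (c : ↥(cubeIdx K) → ℂ) (g : ℂ),
      ∑ i ∈ ((cubeIdx K).biUnion nbrIdx ∪ cubeIdx Kv) \ cubeIdx K,
        ‖∑ j : ↥(cubeIdx K), amc i j * (X (c, g)).1 j‖ ^ 2 ≤
        yC ^ 2 * (∑ j : ↥(cubeIdx K), ‖c j‖ ^ 2 + ‖g‖ ^ 2))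
    (hnC : ∀ z : ↥(cubeIdx K) → ℂ,
      ∑ i ∈ ((cubeIdx K).biUnion nbrIdx ∪ cubeIdx Kv) \ cubeIdx K,
        ‖∑ j : ↥(cubeIdx K), amc i j * z j‖ ^ 2 ≤
        nC ^ 2 * ∑ j : ↥(cubeIdx K), ‖z j‖ ^ 2)
    (hxmu : ∀ (c : ↥(cubeIdx K) → ℂ) (g : ℂ),
      ‖(X (c, g)).2‖ ^ 2 ≤ xmu ^ 2 * (∑ j : ↥(cubeIdx K), ‖c j‖ ^ 2 + ‖g‖ ^ 2))
    (hygB : ∀ e : Idx → ℂ,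
      ‖(X (fun i : ↥(cubeIdx K) => ∑ j ∈ nbrIdx i \ cubeIdx K,
          amc i j * e j, 0)).2‖ ^ 2 ≤
        ygB ^ 2 * ∑ j ∈ (cubeIdx K).biUnion nbrIdx \ cubeIdx K, ‖e j‖ ^ 2)
    (hshellX : ∀ e : Idx → ℂ, (∀ i ∈ cubeIdx K, e i = 0) →
      MU2X * ∑ i ∈ cubeIdx (K + 1) \ cubeIdx K, ‖e i‖ ^ 2 ≤
        ∑ i ∈ cubeIdx (K + 1) \ cubeIdx K, (lt.re - (-(onormSq i.1 / R)) - Real.sqrt 2) * ‖e i‖ ^ 2 -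
        RCLike.re (∑ i ∈ (cubeIdx K).biUnion nbrIdx \ cubeIdx K,
          conj (∑ j : ↥(cubeIdx K), amc i j *
            (X (fun i : ↥(cubeIdx K) => ∑ j ∈ nbrIdx i \ cubeIdx K,
              amc i j * e j, 0)).1 j) * e i))
    -- the derived constants, the tail constant and the closing inequalities
    {α δ βB βC gB MU2 μ M : ℝ} (hαdef : α = nX / (1 - θ)) (hδdef : δ = α * θ)
    (hβBdef : βB = yB + nB * δ) (hβCdef : βC = yC + nC * δ + nt * (xmu + δ))
    (hgBdef : gB = ygB + nB * δ) (hMU2def : MU2 = MU2X - nB * nC * δ)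
    (htailK : MU2 ≤ lt.re + ((K : ℝ) + 2) ^ 2 / R - Real.sqrt 2)
    (hμdef : μ = MU2 - gB * nt) (hμ : 0 < μ)
    (hMdef : M = √((1 + βC ^ 2) / μ ^ 2 + (α + βB * √(1 + βC ^ 2) / μ) ^ 2))
    (hκ : 2 * Real.sqrt 2 * M ^ 2 * r₀ < 1) :
    ∃ lam : ℂ, ‖lam - lt‖ ≤ 2 * M * r₀ ∧
      Torus.IsLinNSEigenvalue (1 / (2 * Real.pi * R)) (Torus.abcFlow 1 1 1) (2 * Real.pi * lam) ∧
      (∀ z : ℂ, z ≠ lam → ‖z - lam‖ < (1 - 2 * Real.sqrt 2 * M ^ 2 * r₀) / M →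
        ∀ w : Idx → ℂ, (Summable fun i : Idx => (1 + onormSq i.1 / R) ^ 2 * ‖w i‖ ^ 2) →
          (∀ i : Idx, ((-(onormSq i.1 / R) : ℝ) : ℂ) * w i +
            ∑ j ∈ nbrIdx i, amc i j * w j = z * w i) → w = 0) ∧
      (lt.im = 0 → 2 * (2 * M * r₀) < (1 - 2 * Real.sqrt 2 * M ^ 2 * r₀) / M → lam.im = 0) ∧
      (∃ w : Idx → ℂ, w ≠ 0 ∧
        (∀ i : Idx, ((-(onormSq i.1 / R) : ℝ) : ℂ) * w i +
          ∑ j ∈ nbrIdx i, amc i j * w j = lam * w i) ∧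
        ∀ s : ℕ, Summable fun i : Idx => (1 + onormSq i.1) ^ s * ‖w i‖ ^ 2) := by
  classical
  -- the outer shell `nbr(cubeIdx K) ∖ cubeIdx K` sits inside the sup-norm shell and inside `K_ext`
  have hKc : (cubeIdx K).biUnion nbrIdx \ cubeIdx K ⊆
      ((cubeIdx K).biUnion nbrIdx ∪ cubeIdx Kv) \ cubeIdx K :=
    Finset.sdiff_subset_sdiff Finset.subset_union_left le_rfl
  have hKsh : (cubeIdx K).biUnion nbrIdx \ cubeIdx K ⊆ cubeIdx (K + 1) \ cubeIdx K := by
    intro j hj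
    rw [Finset.mem_sdiff, Finset.mem_biUnion] at hj
    obtain ⟨⟨i, hi, hij⟩, hjK⟩ := hj
    refine Finset.mem_sdiff.mpr ⟨mem_cubeIdx.mpr ?_, hjK⟩
    exact (osupNorm_le_of_mem_nbrIdx hij).2.trans (Nat.add_le_add_right (mem_cubeIdx.mp hi) 1)
  have hntc : ∑ i ∈ ((cubeIdx K).biUnion nbrIdx ∪ cubeIdx Kv) \ cubeIdx K, ‖vt i‖ ^ 2 ≤ nt ^ 2 := by
    rw [← Finset.sum_subset (Finset.sdiff_subset_sdiff Finset.subset_union_right le_rfl)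
      (fun i hi hi' => by
        rw [Finset.mem_sdiff] at hi hi'
        have : i ∉ cubeIdx Kv := fun h => hi' ⟨h, hi.2⟩
        rw [hvt0 i this, norm_zero, zero_pow two_ne_zero])]
    exact hntb
  obtain ⟨Binv, hBinv, hαM, hβBM, hβCM, hgBM, hshellM⟩ :=
    BorderedEigenpairApproxInverse.exists_borderedInverse_of_approx (cubeIdx K) nbrIdx
      (((cubeIdx K).biUnion nbrIdx ∪ cubeIdx Kv) \ cubeIdx K) (cubeIdx (K + 1) \ cubeIdx K) hKc hKsh
      (fun i j => amc i j) (fun i => lt - ((-(onormSq i.1 / R) : ℝ) : ℂ)) vt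
      (fun i => lt.re - (-(onormSq i.1 / R)) - Real.sqrt 2) X hθ0 hθ1 hnX0 hyB0 hnB0 hyC0 hnC0
      hxmu0 hygB0 hnt hθ hnX hyB hnB hyC hnC hxmu hygB hntc hshellX hαdef hδdef hβBdef hβCdef
      hgBdef hMU2def
  have hα : 0 ≤ α := by rw [hαdef]; exact div_nonneg hnX0 (by linarith)
  have hδ : 0 ≤ δ := by rw [hδdef]; positivity
  have hβB : 0 ≤ βB := by rw [hβBdef]; positivity
  have hβC : 0 ≤ βC := by rw [hβCdef]; positivity
  have hgB : 0 ≤ gB := by rw [hgBdef]; positivity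
  exact isLinNSEigenvalue_near_of_nested_certificate_of_complex_bases wf hws hwt hwII hwon amc hamc hR K Kv lt vt hvt0 hr₀ hnt
    hres hntb Binv hBinv hα hβB hβC hgB hαM hβBM hβCM hgBM hshellM htailK hμdef hμ hMdef hκ

end OfComplexBases

end Summit.NavierStokesRegularity.FluidComputer.AbcClassIIEigenpair

end
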